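import Summits.BirchSwinnertonDyer.BirchSwinnertonDyer.Theorems.CyclotomicUntwistPSRankOneUpperHalfAtThreeOfKoTowerFree
import Summits.BirchSwinnertonDyer.BirchSwinnertonDyer.Theorems.CyclotomicUntwistPSHalvesOfPSOntoRankZeroHalves
import Summits.BirchSwinnertonDyer.BirchSwinnertonDyer.Theorems.CyclotomicUntwistPSIdleBinders
import HarnessLib

/-!
# K2 `PSRankOneUpperHalfAtThree` BY NAME ⟸ published inputs ∧ SOED's tower-free Kolyvagin crux Ko′ ∧ K1₀ —
# the LOWER half on the RANK-ZERO principal-series rows; NO wild rank-zero leaf, NO non-tower residual, NO tower binder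

Cell `pub/bsd-wall` (D-0145 line `route-BirchSwinnertonDyer-CyclotomicUntwist`), seat `bsd-line-cycu-p4` (width
seat 4, gen 4). Helper toward crux K2 `PSRankOneUpperHalfAtThree` (stmt-BirchSwinnertonDyer-21581). THEOREMS ONLY
(no definition, no named fact, no `sorry`); every crux named is an ANTECEDENT; BSD is not proved by this file and no
crux is.

Three kernels of the line are composed:
* cycu-p3 g0, `CyclotomicUntwistPSHalvesOfPSOntoRankZeroHalves` §3:
  K2 ⟸ PUB ∧ Ko (stmt-20480, WITH the `3`-adic tower binder) ∧ K1₀ (lower half on the onto rank-zero PS rows)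
  ∧ «UPPER half on the NON-TOWER rank-one PS rows» — the Heegner twist of an onto PS row is an onto PS row of
  rank `0` (`psOntoRow_twist_of_heegner`), so the rank-zero input Z of SOED's road can be asked on the PS rows;
* cycu-p4 g3, `CyclotomicUntwistPSRankOneUpperHalfAtThreeNonTower` / `…OfKoTowerFree`: on every PS row the `3`-adic
  tower HOLDS (`towerSurjThree_of_addv_of_surj_of_even`), so the non-tower hypothesis is VACUOUS, and SOED's crux of
  record is the tower-free Ko′ (stmt-24696; `wildKolyvaginUpperAtThree_of_towerFree : Ko′ → Ko`);
* cycu-p4 g4, `CyclotomicUntwistPSIdleBinders`: `¬ HasCM` is idle (`not_hasCM_of_surj_three`).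

Result: **`psRankOneUpperHalfAtThree_of_koTowerFree_of_psRankZeroLowerHalf : PublishedInputsWildThree → Ko′ → K1₀ → K2`**
with K1₀ := «∀ W globally minimal, `ClassO6 W 3 → Surj W 3 → v₃(Δ_min)` even `→ Δ_min/3^v ≡ 1 (mod 3) → r_an = 0 →
MissingLowerBoundAt W 3`» — K1's own text with `r_an = 1 ↦ r_an = 0` (the finite-slope road's EASIER case: the
value `L(E,1)` instead of `L′(E,1)`, no `3`-adic Gross–Zagier, no height; typed by cycu-p3 g2's
`CyclotomicUntwistFiniteSlopeRankZero.rankZero_halves_of_valueFormula`). So, BY NAME and modulo print (PUB), **K2 = Ko′ + K1₀**: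
the import of the whole wild rank-zero leaf `WildRankZeroTwistAtThree` = `WAllExclAddWildRankZero` (UTD/SOED residual
#6, 3 072 + … classes incl. every SUPERCUSPIDAL rank-zero row) that the earlier forms
`psRankOneUpperHalfAtThree_of_koTowerFree_of_rankZeroLeaf` / `stub_upperHalf_tower_of_koTowerFree` carried is replaced by a
statement on the principal-series rows alone, in the route's own binders. Also the registered K2 stub
`stub_upperHalf_tower` in its binders modulo {PUB, Ko′, K1₀} (`stub_upperHalf_tower_of_koTowerFree_of_psRankZeroLowerHalf`),
and the `¬ CM`-free K1₀ is enough (`…_of_psRankZeroLowerHalfCMFree`).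

References: [GrossZagier1986] Thm. I.(6.3), (7.3); [Kolyvagin1990] Thm. A; [Jetchev2008] Thm. 1.4;
[JetchevSkinnerWan2017] §7.4.1; [FriedbergHoffstein1995] Thm. B; [SilvermanAEC2009] X.5 Cor. 5.4; [Zywina2015] Prop. 1.14.
-/

noncomputable section

open scoped Classical

-- single-conjunct summit: `Summit.BirchSwinnertonDyer.BirchSwinnertonDyer.…` repeats the name by design
set_option linter.dupNamespace false
set_option autoImplicit false

namespace Summit.BirchSwinnertonDyer.BirchSwinnertonDyer.Theorems.PSUpperHalfOfKoRankZero

open WeierstrassCurve Literature.NumberTheory.EllipticCurves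
  Literature.NumberTheory.EllipticCurves.Rank1Residual
  Literature.NumberTheory.EllipticCurves.Rank1Residual.Typed
  Summit.BirchSwinnertonDyer.Rank1Residual
  Summit.BirchSwinnertonDyer.Rank1Residual.Additive
  Summit.BirchSwinnertonDyer.BirchSwinnertonDyer.Theses.SemiOrdinaryEisensteinDescent
  Summit.BirchSwinnertonDyer.BirchSwinnertonDyer.Theorems

/-- **K2 BY NAME ⟸ published inputs ∧ Ko′ ∧ K1₀ (the LOWER half on the rank-ZERO principal-series rows).**
On a K2 row (`ClassO6 W 3`, `ρ̄_{E,3}` onto, `v₃(Δ_min)` even, `Δ_min/3^v ≡ 1 (mod 3)`, `r_an = 1`): the `3`-adic tower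
holds (cycu-p4 g3), Ko′ gives Ko, the odd Heegner twist is an onto PS row of analytic rank `0` (cycu-p3 g0
`psOntoRow_twist_of_heegner`) whose LOWER half K1₀ supplies, and the Gross–Zagier bookkeeping descends the joint
upper bound (`CyclotomicUntwistOfSOED.psRankOneUpperHalfAtThree_of_kolyvaginCrux_of_psRankZeroLowerHalfOnto_of_psNonTowerUpperHalf`
with its non-tower hypothesis discharged VACUOUSLY). CONDITIONAL; closes nothing; BSD is not proved by this.
[cite: JetchevSkinnerWan2017, §7.4.1 (arXiv:1512.06894 p. 30)] [cite: Jetchev2008, Thm. 1.4] [cite: SilvermanAEC2009, X.5 Cor. 5.4] -/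
theorem psRankOneUpperHalfAtThree_of_koTowerFree_of_psRankZeroLowerHalf (hF : PublishedInputsWildThree)
    (hKo' : WildKolyvaginUpperAtThreeTowerFree)
    (hL0 : ∀ (Wd : WeierstrassCurve ℚ) [Wd.IsElliptic] [Wd.IsGloballyMinimal],
      ¬ Wd.HasCM → ClassO6 Wd 3 → Surj Wd 3 →
      Even (padicValInt 3 Wd.minimalDiscriminantInt) →
      Wd.minimalDiscriminantInt / 3 ^ padicValInt 3 Wd.minimalDiscriminantInt % 3 = 1 →
      Wd.analyticRank = 0 → MissingLowerBoundAt Wd 3) :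
    Summit.BirchSwinnertonDyer.BirchSwinnertonDyer.Theses.CyclotomicUntwist.PSRankOneUpperHalfAtThree :=
  CyclotomicUntwistOfSOED.psRankOneUpperHalfAtThree_of_kolyvaginCrux_of_psRankZeroLowerHalfOnto_of_psNonTowerUpperHalf
    hF (PSUpperHalfOfKoTowerFree.wildKolyvaginUpperAtThree_of_towerFree hKo') hL0
    (fun W _ _ _ hO6 hsurj hnt hev _ _ ↦
      absurd (PSUpperHalfOfKoTowerFree.towerSurjThree_of_addv_of_surj_of_even W hO6.2.1 hsurj hev) hnt)

/-- **K2 BY NAME ⟸ published inputs ∧ Ko′ ∧ the `¬ CM`-FREE K1₀** (the rank-zero companion in exactly K1's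
binders with `r_an = 0`; `¬ CM` is idle on both sides, `PSIdleBinders.not_hasCM_of_surj_three`). CONDITIONAL.
[cite: JetchevSkinnerWan2017, §7.4.1 (arXiv:1512.06894 p. 30)] [cite: Zywina2015, Prop. 1.14 and Prop. 1.16 (§1.9)] -/
theorem psRankOneUpperHalfAtThree_of_koTowerFree_of_psRankZeroLowerHalfCMFree (hF : PublishedInputsWildThree)
    (hKo' : WildKolyvaginUpperAtThreeTowerFree)
    (hL0 : ∀ (Wd : WeierstrassCurve ℚ) [Wd.IsElliptic] [Wd.IsGloballyMinimal],
      ClassO6 Wd 3 → Surj Wd 3 →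
      Even (padicValInt 3 Wd.minimalDiscriminantInt) →
      Wd.minimalDiscriminantInt / 3 ^ padicValInt 3 Wd.minimalDiscriminantInt % 3 = 1 →
      Wd.analyticRank = 0 → MissingLowerBoundAt Wd 3) :
    Summit.BirchSwinnertonDyer.BirchSwinnertonDyer.Theses.CyclotomicUntwist.PSRankOneUpperHalfAtThree :=
  psRankOneUpperHalfAtThree_of_koTowerFree_of_psRankZeroLowerHalf hF hKo'
    (fun Wd _ _ _ hO6d hsd hevd hsqd hrd ↦ hL0 Wd hO6d hsd hevd hsqd hrd)

/-- **The registered K2 stub `stub_upperHalf_tower` (line `birth` v2) in ITS binders, modulo published inputs ∧ Ko′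
∧ K1₀** (re-keying of cycu-p4 g3's `stub_upperHalf_tower_of_koTowerFree`: the wild rank-zero leaf Z replaced by the
lower half on the rank-zero PS rows; CONDITIONAL helper — a registered stub closes only unconditionally).
[cite: JetchevSkinnerWan2017, §7.4.1 (arXiv:1512.06894 p. 30)] [cite: Jetchev2008, Thm. 1.4] -/
theorem stub_upperHalf_tower_of_koTowerFree_of_psRankZeroLowerHalf (hF : PublishedInputsWildThree)
    (hKo' : WildKolyvaginUpperAtThreeTowerFree)
    (hL0 : ∀ (Wd : WeierstrassCurve ℚ) [Wd.IsElliptic] [Wd.IsGloballyMinimal],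
      ¬ Wd.HasCM → ClassO6 Wd 3 → Surj Wd 3 →
      Even (padicValInt 3 Wd.minimalDiscriminantInt) →
      Wd.minimalDiscriminantInt / 3 ^ padicValInt 3 Wd.minimalDiscriminantInt % 3 = 1 →
      Wd.analyticRank = 0 → MissingLowerBoundAt Wd 3) :
    ∀ (W : WeierstrassCurve ℚ) [W.IsElliptic] [W.IsGloballyMinimal],
      ¬ W.HasCM → ClassO6 W 3 → Surj W 3 → (∀ n : ℕ, W.HasSurjectiveModNGaloisRep (3 ^ n : ℕ)) →
      Even (padicValInt 3 W.minimalDiscriminantInt) →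
      W.minimalDiscriminantInt / 3 ^ padicValInt 3 W.minimalDiscriminantInt % 3 = 1 →
      W.analyticRank = 1 → MissingUpperBoundAt W 3 :=
  fun W _ _ hCM hO6 hsurj _ hev hsq hr ↦
    psRankOneUpperHalfAtThree_of_koTowerFree_of_psRankZeroLowerHalf hF hKo' hL0 W hCM hO6 hsurj hev hsq hr

end Summit.BirchSwinnertonDyer.BirchSwinnertonDyer.Theorems.PSUpperHalfOfKoRankZero

end
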